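import Literature.NumberTheory.Automorphic.UnitOrbitalIntegralFixedPoints      -- ★ p839788: the COMPACT-centraliser reading (+ ★ (h1)(h2)(h3) `OrbitalIntegralDoubleCosetUnfolding`, ★ D-S1g, ★ `compactCore`)
import Literature.NumberTheory.Automorphic.CompactCoreCentralizerNonarch       -- ★ `exists_isHaarMeasure_compactCore_eq_one`, `subset_compactCore_of_isCompact`
import Literature.MeasureTheory.Group.SubgroupRelIndexMeasure                  -- ★ `measure_subgroup_eq_relIndex_mul_of_isCompact` (`t C₀ = [C₀ : S] · t S`)
import Literature.NumberTheory.Automorphic.UnitaryUnitOrbitalIntegralFixedPoints -- ★ `classOrbitalIntegral_indicator_complex_eq_ofReal` (the letters' `ℂ` currency)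
import HarnessLib

/-!
# The unit orbital integral at an element with NON-COMPACT centraliser is a fixed-point count PER PERIOD:
# `O_γ(1_K) = ν(K) · Σ_{x ∈ K\G/C_G(γ), γ·x⁻¹K = x⁻¹K} [C₀ : C_G(γ) ∩ x⁻¹ K x]`, `C₀` the compact core of `C_G(γ)`
(Laumon, *Cohomology of Drinfeld modular varieties* I (1996), Lemma (5.3.2) «`O_γ(1_{K}∕vol) = Σ_τ 1 ∕ vol(G_γ(F)_τ, dg_γ)`, `τ` over the
`G_γ(F)`-orbits of `γ`-fixed facets»; Kottwitz, *Tamagawa numbers* (1988), §2 (orbital integrals of Euler–Poincaré functions at NON-elliptic `γ`);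
Rogawski (1990), §4.9 p. 54, §4.3 p. 43 (measures on `G_γ` normalised on the maximal compact subgroup))

Topic `NumberTheory/Automorphic`; namespace `Literature.NumberTheory.Automorphic`.  THEOREMS ONLY (no definition, no instance, no notation, no named
fact, no `sorry`).  Cell `pub/hodgecm-mathlib`, F0∕P3a, crux H413 = stmt-HodgeConjecture-24833, line «N6nsGerm» residual `stub_N6nsR2EP` (★-def
`Rogawski1990.RankOneEulerPoincareNonsplit`), (R2) EP road — RAMIFIED half census `F0/P3a/A-p06/g27/CENSUS-R2ram-RamifiedEulerPoincare.A-p06g27.md` §4 (N1)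
(LEAD F0P3a-plan (g10) WORD T9-6 (2); co-hand A-p17 (g22) 08:27:08Z split; seat A-p06 (g27), strategy «generalise-then-specialise»).  HONEST LABEL: HC_CM
is proved only modulo the printed citations until rung 0 closes; nothing printed is asserted here — this is the GENERIC non-compact twin of ★ p839788
`UnitOrbitalIntegralFixedPoints` (compact centraliser: `O_γ(1_K) = #Fix_γ(G⧸K) · ν(K) ∕ t(C)`), i.e. the (N)-side currency of the Euler–Poincaré glue ★ p842588
`RankOneEulerPoincareGlue` («per period of the split torus, fixed vertices − fixed edges = 0»).

THE MATHEMATICS.  `G` locally compact, second countable, Hausdorff; `K ≤ G` compact open; `γ ∈ G` with CLOSED conjugacy class and centraliser `C = C_G(γ)`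
(closed); `C₀ ≤ C` a COMPACT OPEN subgroup containing the compact core of `C` (hence EQUAL to it: every compact subgroup of `C` lies in `C₀` — for a torus
`T(F_v)` this is its maximal compact subgroup `T(F_v)_c`, e.g. `𝒪_w^× ⊂ L_w^×`); `t` a left Haar measure on `C` with `t(C₀) = 1` (the ★ `IsCanonical` normalisation
«mass one on the compact core»), `ν` a Haar measure on `G`.  By ★ (h2) `orbitalIntegral_indicator_quotientMeasure_eq_sum_of_isClosed`,
`O_γ^{ν∕t}(1_K) = Σ_{q ∈ K\G∕C} 1_K(x γ x⁻¹) · ν(K) ∕ t(S_x)`, `x = q.out`, `S_x = {c ∈ C | x c x⁻¹ ∈ K} = C ∩ x⁻¹Kx` (a finite sum at a closed class).  Each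
`S_x` is a compact open subgroup of `C`, hence `S_x ≤ C₀` of finite index and `t(S_x) = t(C₀) ∕ [C₀ : S_x] = [C₀ : S_x]⁻¹` (★ `measure_subgroup_eq_relIndex_mul_of_isCompact`).
Hence **`O_γ^{ν∕t}(1_K) = ν(K) · Σ_{q : γ fixes q.out⁻¹K} [C₀ : C ∩ q.out⁻¹ K q.out]`** — Laumon's «sum over the `C`-orbits of `γ`-fixed points of `G⧸K` of the inverse
stabiliser volumes», with the inverse volume READ AS AN INDEX: `[C₀ : Stab_C(y)]` is the number of points of the `C₀`-orbit of the fixed point `y = x⁻¹K` (orbit–stabiliser),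
so the sum counts the `γ`-fixed points of `G ⧸ K` «modulo the non-compact part of `C`», i.e. PER PERIOD: if `C = A · C₀` with `A ∩ C₀ = 1` (a discrete complement,
e.g. `A = ϖ^ℤ` in `L_w^× = ϖ^ℤ × 𝒪_w^×`), each `C`-orbit `O` contributes `#(O ∕ A)`.  At a COMPACT centraliser (`C₀ = C`, every index `= #(C`-orbit`)`) this is ★ p839788's
`#Fix_γ(G⧸K) · ν(K)`.

* §1 `subgroupOf_comap_conj_le_of_compactCore_subset` (`S_x ≤ C₀`), `relIndex_subgroupOf_comap_conj_ne_zero`, **`measure_setOf_conj_mem_eq_inv_relIndex`**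
  (`t(S_x) = [C₀ : S_x]⁻¹` when `t(C₀) = 1`), `measure_div_measure_setOf_conj_mem_eq_mul_relIndex` (the weight `ν(K) ∕ t(S_x) = ν(K) · [C₀ : S_x]`).
* §2 **`orbitalIntegral_indicator_quotientMeasure_eq_mul_sum_relIndex`** — the displayed formula (real indicator, any finite `s ⊇` the contributing classes);
  `…_of_measure_eq_one` (`ν(K) = 1`).
* §3 the CLASS reading over ★ D-S1g for a CANONICAL family on a COMMUTATIVE centraliser (tori): **`classOrbitalIntegral_indicator_eq_mul_sum_relIndex`** —
  `classOrbitalIntegral m 1_K ⟦γ⟧ = ν(K) · Σ_{q fixed} [C₀ : S_{q.out}]` (`m` canonical for `(P, ν)`, `P γ`, `P` conjugation-invariant; the canonical `t` exists by ★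
  `exists_isHaarMeasure_compactCore_eq_one`), and its `ℂ`-valued twin.

NOT here (next file, census §4 (N1) second half ∕ (N2)): the intrinsic «`#(Fix ∕ A)`» form and the tube-about-the-axis count on the lattice tree.

## References
* [Laumon1995] G. Laumon, *Cohomology of Drinfeld Modular Varieties* I, Cambridge Stud. Adv. Math. 41 (1996), Lemma (5.3.2) p. 136.
* [Kottwitz1988] R. E. Kottwitz, *Tamagawa numbers*, Ann. of Math. 127 (1988), §2 (Theorem 2, non-elliptic case).
* [Rogawski1990] J. D. Rogawski, *Automorphic Representations of Unitary Groups in Three Variables*, Ann. of Math. Stud. 123 (1990), §4.9 p. 54; §4.3 p. 43.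
* [DeitmarEchterhoff2014] A. Deitmar, S. Echterhoff, *Principles of Harmonic Analysis*, 2nd ed. (2014), Thm. 1.5.3, Lemma 9.3.3.
-/

set_option autoImplicit false

noncomputable section

open MeasureTheory Measure Topology Filter Set
open scoped ENNReal NNReal Pointwise

namespace Literature.NumberTheory.Automorphic

open Literature.MeasureTheory.Group

/-! ## §1 The stabilisers `S_x = C ∩ x⁻¹ K x` sit inside the compact core with finite index; their mass is the inverse index -/

section Stabiliser

variable {G : Type*} [Group G] [TopologicalSpace G] [IsTopologicalGroup G] [T2Space G] (γ : G) (K : Subgroup G)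
  (C₀ : Subgroup (Subgroup.centralizer ({γ} : Set G)))

omit [TopologicalSpace G] [IsTopologicalGroup G] [T2Space G] in
/-- The stabiliser set of ★ (h2), `{c ∈ C_G(γ) | x c x⁻¹ ∈ K}`, is the carrier of the subgroup `(x⁻¹ K x) ⊓ C` of `↥C_G(γ)`. [cite: Laumon1995, Lemma (5.3.2) p. 136] -/
theorem coe_subgroupOf_comap_conj (x : G) :
    (((K.comap (MulAut.conj x).toMonoidHom).subgroupOf (Subgroup.centralizer ({γ} : Set G)) :
        Subgroup (Subgroup.centralizer ({γ} : Set G))) : Set (Subgroup.centralizer ({γ} : Set G))) =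
      {c : Subgroup.centralizer ({γ} : Set G) | x * (c : G) * x⁻¹ ∈ K} := rfl

omit [T2Space G] in
/-- `S_x = C ∩ x⁻¹ K x` is OPEN in `C` for `K` open. [cite: Laumon1995, Lemma (5.3.2) p. 136] -/
theorem isOpen_coe_subgroupOf_comap_conj (hK : IsOpen (K : Set G)) (x : G) :
    IsOpen (((K.comap (MulAut.conj x).toMonoidHom).subgroupOf (Subgroup.centralizer ({γ} : Set G)) :
        Subgroup (Subgroup.centralizer ({γ} : Set G))) : Set (Subgroup.centralizer ({γ} : Set G))) :=
  (isOpen_coe_comap_conj K hK x).preimage continuous_subtype_val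

/-- `S_x = C ∩ x⁻¹ K x` is COMPACT for `K` compact (`C` is closed). [cite: Laumon1995, Lemma (5.3.2) p. 136] -/
theorem isCompact_coe_subgroupOf_comap_conj (hKc : IsCompact (K : Set G)) (x : G) :
    IsCompact (((K.comap (MulAut.conj x).toMonoidHom).subgroupOf (Subgroup.centralizer ({γ} : Set G)) :
        Subgroup (Subgroup.centralizer ({γ} : Set G))) : Set (Subgroup.centralizer ({γ} : Set G))) :=
  (isClosed_coe_centralizer_singleton γ).isClosedEmbedding_subtypeVal.isCompact_preimage (isCompact_coe_comap_conj K hKc x)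

/-- **`S_x ≤ C₀`**: a compact subgroup of `C` lies in the compact core, hence in any subgroup `C₀` containing the compact core. [cite: Rogawski1990, §4.3 p. 43] -/
theorem subgroupOf_comap_conj_le_of_compactCore_subset (hKc : IsCompact (K : Set G))
    (hcore : compactCore (Subgroup.centralizer ({γ} : Set G)) ⊆ C₀) (x : G) :
    (K.comap (MulAut.conj x).toMonoidHom).subgroupOf (Subgroup.centralizer ({γ} : Set G)) ≤ C₀ :=
  fun _ hc => hcore (subset_compactCore_of_isCompact (isCompact_coe_subgroupOf_comap_conj γ K hKc x) hc)

omit [IsTopologicalGroup G] [T2Space G] in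
/-- **A compact open `C₀` containing the compact core IS the compact core.** [cite: Rogawski1990, §4.3 p. 43] -/
theorem compactCore_eq_coe_of_subset (hC₀c : IsCompact (C₀ : Set (Subgroup.centralizer ({γ} : Set G))))
    (hcore : compactCore (Subgroup.centralizer ({γ} : Set G)) ⊆ C₀) :
    compactCore (Subgroup.centralizer ({γ} : Set G)) = (C₀ : Set (Subgroup.centralizer ({γ} : Set G))) :=
  Subset.antisymm hcore (subset_compactCore_of_isCompact hC₀c)

omit [T2Space G] in
/-- **`[C₀ : S_x]` is finite** (`S_x` open, `C₀` compact). [cite: PlatonovRapinchuk1994, §3.3] -/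
theorem relIndex_subgroupOf_comap_conj_ne_zero (hK : IsOpen (K : Set G)) (hC₀c : IsCompact (C₀ : Set (Subgroup.centralizer ({γ} : Set G)))) (x : G) :
    ((K.comap (MulAut.conj x).toMonoidHom).subgroupOf (Subgroup.centralizer ({γ} : Set G))).relIndex C₀ ≠ 0 :=
  relIndex_ne_zero_of_isCompact_of_isOpen hC₀c (isOpen_coe_subgroupOf_comap_conj γ K hK x)

variable [MeasurableSpace G] [BorelSpace G] (t : Measure (Subgroup.centralizer ({γ} : Set G))) [t.IsMulLeftInvariant]

/-- **`t(C₀) = [C₀ : S_x] · t(S_x)`** for a left-invariant Borel `t` on `C` (★ `measure_subgroup_eq_relIndex_mul_of_isCompact`). [cite: Rogawski1990, §4.3 p. 43] [cite: Laumon1995, Lemma (5.3.2) p. 136] -/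
theorem measure_coe_eq_relIndex_mul_measure_setOf_conj_mem (hK : IsOpen (K : Set G)) (hKc : IsCompact (K : Set G))
    (hC₀c : IsCompact (C₀ : Set (Subgroup.centralizer ({γ} : Set G)))) (hC₀o : IsOpen (C₀ : Set (Subgroup.centralizer ({γ} : Set G))))
    (hcore : compactCore (Subgroup.centralizer ({γ} : Set G)) ⊆ C₀) (x : G) :
    t C₀ = ((K.comap (MulAut.conj x).toMonoidHom).subgroupOf (Subgroup.centralizer ({γ} : Set G))).relIndex C₀ *
      t {c : Subgroup.centralizer ({γ} : Set G) | x * (c : G) * x⁻¹ ∈ K} := by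
  haveI : BorelSpace (Subgroup.centralizer ({γ} : Set G)) := Subtype.borelSpace _
  rw [← coe_subgroupOf_comap_conj γ K x]
  exact (measure_subgroup_eq_relIndex_mul_of_isCompact t (subgroupOf_comap_conj_le_of_compactCore_subset γ K C₀ hKc hcore x) hC₀c hC₀o
    (isOpen_coe_subgroupOf_comap_conj γ K hK x)).2

/-- **`t(S_x) = [C₀ : S_x]⁻¹`** under the canonical normalisation `t(C₀) = 1`. [cite: Rogawski1990, §4.3 p. 43] [cite: Laumon1995, Lemma (5.3.2) p. 136] -/
theorem measure_setOf_conj_mem_eq_inv_relIndex (hK : IsOpen (K : Set G)) (hKc : IsCompact (K : Set G))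
    (hC₀c : IsCompact (C₀ : Set (Subgroup.centralizer ({γ} : Set G)))) (hC₀o : IsOpen (C₀ : Set (Subgroup.centralizer ({γ} : Set G))))
    (hcore : compactCore (Subgroup.centralizer ({γ} : Set G)) ⊆ C₀) (ht : t C₀ = 1) (x : G) :
    t {c : Subgroup.centralizer ({γ} : Set G) | x * (c : G) * x⁻¹ ∈ K} =
      ((((K.comap (MulAut.conj x).toMonoidHom).subgroupOf (Subgroup.centralizer ({γ} : Set G))).relIndex C₀ : ℕ) : ℝ≥0∞)⁻¹ := by
  have h := measure_coe_eq_relIndex_mul_measure_setOf_conj_mem γ K C₀ t hK hKc hC₀c hC₀o hcore x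
  rw [ht] at h
  rw [ENNReal.eq_inv_of_mul_eq_one_left h.symm, inv_inv]

/-- **The weight of ★ (h2) read as an index: `ν(K) ∕ t(S_x) = ν(K) · [C₀ : S_x]`.** [cite: Laumon1995, Lemma (5.3.2) p. 136] -/
theorem measure_div_measure_setOf_conj_mem_eq_mul_relIndex (hK : IsOpen (K : Set G)) (hKc : IsCompact (K : Set G))
    (hC₀c : IsCompact (C₀ : Set (Subgroup.centralizer ({γ} : Set G)))) (hC₀o : IsOpen (C₀ : Set (Subgroup.centralizer ({γ} : Set G))))
    (hcore : compactCore (Subgroup.centralizer ({γ} : Set G)) ⊆ C₀) (ht : t C₀ = 1) (ν : Measure G) (x : G) :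
    ν K / t {c : Subgroup.centralizer ({γ} : Set G) | x * (c : G) * x⁻¹ ∈ K} =
      ν K * ((((K.comap (MulAut.conj x).toMonoidHom).subgroupOf (Subgroup.centralizer ({γ} : Set G))).relIndex C₀ : ℕ) : ℝ≥0∞) := by
  rw [measure_setOf_conj_mem_eq_inv_relIndex γ K C₀ t hK hKc hC₀c hC₀o hcore ht x, div_eq_mul_inv, inv_inv]

end Stabiliser

/-! ## §2 The orbital integral of `1_K` as `ν(K)` times a sum of indices -/

section Orbital

variable {G : Type*} [Group G] [TopologicalSpace G] [IsTopologicalGroup G] [LocallyCompactSpace G]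
  [SecondCountableTopology G] [T2Space G] [MeasurableSpace G] [BorelSpace G]
  (γ : G) (K : Subgroup G) (C₀ : Subgroup (Subgroup.centralizer ({γ} : Set G)))
  [MeasurableSpace (G ⧸ Subgroup.centralizer ({γ} : Set G))]
  [BorelSpace (G ⧸ Subgroup.centralizer ({γ} : Set G))]
  [hC : IsClosed ((Subgroup.centralizer ({γ} : Set G) : Subgroup G) : Set G)]
  (t : Measure (Subgroup.centralizer ({γ} : Set G))) [t.IsMulLeftInvariant]
  [IsFiniteMeasureOnCompacts t] [t.IsOpenPosMeasure] [t.IsInvInvariant] [SFinite t]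
  (ν : Measure G) [IsHaarMeasure ν] [ν.IsMulRightInvariant]

/-- **THE UNIT ORBITAL INTEGRAL PER PERIOD.**  For `K` compact open, `γ` with closed conjugacy class, `C₀ ≤ C_G(γ)` compact open containing the compact core, `t`
left-invariant on `C_G(γ)` with `t(C₀) = 1`, `ν` Haar on `G`, and any finite set `s` of classes in `K\G∕C_G(γ)` off which `q.out γ q.out⁻¹ ∉ K`:
`O_γ^{ν∕t}(1_K) = ν(K) · Σ_{q ∈ s, q.out γ q.out⁻¹ ∈ K} [C₀ : C_G(γ) ∩ q.out⁻¹ K q.out]`. [cite: Laumon1995, Lemma (5.3.2) p. 136] [cite: Kottwitz1988, §2] [cite: Rogawski1990, §4.9 p. 54] -/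
theorem orbitalIntegral_indicator_quotientMeasure_eq_mul_sum_relIndex (hO : IsClosed {g | ∃ y : G, y * γ * y⁻¹ = g})
    (hK : IsOpen (K : Set G)) (hKc : IsCompact (K : Set G))
    (hC₀c : IsCompact (C₀ : Set (Subgroup.centralizer ({γ} : Set G)))) (hC₀o : IsOpen (C₀ : Set (Subgroup.centralizer ({γ} : Set G))))
    (hcore : compactCore (Subgroup.centralizer ({γ} : Set G)) ⊆ C₀) (ht : t C₀ = 1)
    (s : Finset (DoubleCoset.Quotient (K : Set G) (Subgroup.centralizer ({γ} : Set G) : Set G)))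
    (hs : ∀ q, q ∉ s → q.out * γ * q.out⁻¹ ∉ K) :
    orbitalIntegral γ ((K : Set G).indicator (1 : G → ℝ)) (quotientMeasure (Subgroup.centralizer ({γ} : Set G)) t hC ν) =
      (ν K).toReal * ∑ q ∈ s, (K : Set G).indicator (1 : G → ℝ) (q.out * γ * q.out⁻¹) *
        ((((K.comap (MulAut.conj q.out).toMonoidHom).subgroupOf (Subgroup.centralizer ({γ} : Set G))).relIndex C₀ : ℕ) : ℝ) := by
  rw [orbitalIntegral_indicator_quotientMeasure_eq_sum_of_isClosed γ K t ν hO hK hKc s hs, Finset.mul_sum]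
  refine Finset.sum_congr rfl fun q _ => ?_
  rw [measure_div_measure_setOf_conj_mem_eq_mul_relIndex γ K C₀ t hK hKc hC₀c hC₀o hcore ht ν q.out, ENNReal.toReal_mul,
    ENNReal.toReal_natCast]
  ring

/-- **`ν(K) = 1`**: `O_γ^{ν∕t}(1_K) = Σ_{q ∈ s, fixed} [C₀ : C_G(γ) ∩ q.out⁻¹ K q.out]`. [cite: Laumon1995, Lemma (5.3.2) p. 136] [cite: Rogawski1990, §4.3 p. 43] -/
theorem orbitalIntegral_indicator_quotientMeasure_eq_sum_relIndex_of_measure_eq_one (hO : IsClosed {g | ∃ y : G, y * γ * y⁻¹ = g})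
    (hK : IsOpen (K : Set G)) (hKc : IsCompact (K : Set G))
    (hC₀c : IsCompact (C₀ : Set (Subgroup.centralizer ({γ} : Set G)))) (hC₀o : IsOpen (C₀ : Set (Subgroup.centralizer ({γ} : Set G))))
    (hcore : compactCore (Subgroup.centralizer ({γ} : Set G)) ⊆ C₀) (ht : t C₀ = 1) (hν : ν K = 1)
    (s : Finset (DoubleCoset.Quotient (K : Set G) (Subgroup.centralizer ({γ} : Set G) : Set G)))
    (hs : ∀ q, q ∉ s → q.out * γ * q.out⁻¹ ∉ K) :
    orbitalIntegral γ ((K : Set G).indicator (1 : G → ℝ)) (quotientMeasure (Subgroup.centralizer ({γ} : Set G)) t hC ν) =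
      ∑ q ∈ s, (K : Set G).indicator (1 : G → ℝ) (q.out * γ * q.out⁻¹) *
        ((((K.comap (MulAut.conj q.out).toMonoidHom).subgroupOf (Subgroup.centralizer ({γ} : Set G))).relIndex C₀ : ℕ) : ℝ) := by
  rw [orbitalIntegral_indicator_quotientMeasure_eq_mul_sum_relIndex γ K C₀ t ν hO hK hKc hC₀c hC₀o hcore ht s hs, hν, ENNReal.toReal_one, one_mul]

end Orbital

/-! ## §3 The class reading for a canonical family (commutative centraliser) -/

section Canonical

variable {G : Type*} [Group G] [TopologicalSpace G] [IsTopologicalGroup G] [LocallyCompactSpace G]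
  [SecondCountableTopology G] [T2Space G] [MeasurableSpace G] [BorelSpace G]
  [∀ γ : G, MeasurableSpace (G ⧸ Subgroup.centralizer ({γ} : Set G))]
  [∀ γ : G, BorelSpace (G ⧸ Subgroup.centralizer ({γ} : Set G))]

/-- **THE CLASS READING PER PERIOD: `classOrbitalIntegral m 1_K ⟦γ⟧ = ν(K) · Σ_{q fixed} [C₀ : C_G(γ) ∩ q.out⁻¹ K q.out]`** for a family `m` CANONICAL for `(P, ν)`
(★ `IsCanonical`: mass one on the compact core), `P` conjugation-invariant with `P γ`, the class of `γ` closed, `K` compact open, the centraliser `C_G(γ)` COMMUTATIVE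
(a torus) with compact core contained in the compact open subgroup `C₀` (hence equal to it; the canonical `t` exists by ★ `exists_isHaarMeasure_compactCore_eq_one`).
At a compact centraliser (`C₀ = ⊤`) this is ★ p839788 `classOrbitalIntegral_indicator_eq_card_fixedBy`. [cite: Laumon1995, Lemma (5.3.2) p. 136] [cite: Kottwitz1988, §2]
[cite: Rogawski1990, §4.9 p. 54; §4.3 p. 43] -/
theorem classOrbitalIntegral_indicator_eq_mul_sum_relIndex {P : G → Prop} (hP : ∀ g x : G, P g → P (x * g * x⁻¹))
    {ν : Measure G} [ν.IsHaarMeasure] [ν.IsMulRightInvariant] {m : OrbitalMeasureFamily G} (hm : m.IsCanonical P ν)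
    {γ : G} (hγ : P γ) (hcomm : ∀ a b : Subgroup.centralizer ({γ} : Set G), a * b = b * a)
    (C₀ : Subgroup (Subgroup.centralizer ({γ} : Set G))) (hC₀c : IsCompact (C₀ : Set (Subgroup.centralizer ({γ} : Set G))))
    (hC₀o : IsOpen (C₀ : Set (Subgroup.centralizer ({γ} : Set G)))) (hcore : compactCore (Subgroup.centralizer ({γ} : Set G)) ⊆ C₀)
    (K : Subgroup G) (hK : IsOpen (K : Set G)) (hKc : IsCompact (K : Set G)) (hO : IsClosed {g | ∃ y : G, y * γ * y⁻¹ = g})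
    (s : Finset (DoubleCoset.Quotient (K : Set G) (Subgroup.centralizer ({γ} : Set G) : Set G)))
    (hs : ∀ q, q ∉ s → q.out * γ * q.out⁻¹ ∉ K) :
    classOrbitalIntegral m ((K : Set G).indicator (1 : G → ℝ)) (ConjClasses.mk γ) =
      (ν K).toReal * ∑ q ∈ s, (K : Set G).indicator (1 : G → ℝ) (q.out * γ * q.out⁻¹) *
        ((((K.comap (MulAut.conj q.out).toMonoidHom).subgroupOf (Subgroup.centralizer ({γ} : Set G))).relIndex C₀ : ℕ) : ℝ) := by
  haveI : BorelSpace (Subgroup.centralizer ({γ} : Set G)) := Subtype.borelSpace _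
  haveI : LocallyCompactSpace (Subgroup.centralizer ({γ} : Set G)) :=
    (isClosed_coe_centralizer_singleton γ).isClosedEmbedding_subtypeVal.locallyCompactSpace
  have hcc : compactCore (Subgroup.centralizer ({γ} : Set G)) = (C₀ : Set (Subgroup.centralizer ({γ} : Set G))) :=
    compactCore_eq_coe_of_subset γ C₀ hC₀c hcore
  obtain ⟨t, ht, hti, ht1⟩ := exists_isHaarMeasure_compactCore_eq_one hcomm (hcc ▸ hC₀c) (hcc ▸ hC₀o)
  haveI := ht
  haveI := hti
  haveI : IsClosed ((Subgroup.centralizer ({γ} : Set G) : Subgroup G) : Set G) := isClosed_coe_centralizer_singleton γ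
  have ht1' : t C₀ = 1 := by rw [← hcc]; exact ht1
  rw [hm.classOrbitalIntegral_mk_eq_orbitalIntegral' hP hγ t ht1]
  exact orbitalIntegral_indicator_quotientMeasure_eq_mul_sum_relIndex γ K C₀ t ν hO hK hKc hC₀c hC₀o hcore ht1' s hs

/-- `ℂ`-valued twin (the letters' currency, ★ `orbitalIntegral_indicator_complex_eq_ofReal`). [cite: Laumon1995, Lemma (5.3.2) p. 136] [cite: Rogawski1990, §4.9 p. 54] -/
theorem classOrbitalIntegral_indicator_complex_eq_mul_sum_relIndex {P : G → Prop} (hP : ∀ g x : G, P g → P (x * g * x⁻¹))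
    {ν : Measure G} [ν.IsHaarMeasure] [ν.IsMulRightInvariant] {m : OrbitalMeasureFamily G} (hm : m.IsCanonical P ν)
    {γ : G} (hγ : P γ) (hcomm : ∀ a b : Subgroup.centralizer ({γ} : Set G), a * b = b * a)
    (C₀ : Subgroup (Subgroup.centralizer ({γ} : Set G))) (hC₀c : IsCompact (C₀ : Set (Subgroup.centralizer ({γ} : Set G))))
    (hC₀o : IsOpen (C₀ : Set (Subgroup.centralizer ({γ} : Set G)))) (hcore : compactCore (Subgroup.centralizer ({γ} : Set G)) ⊆ C₀)
    (K : Subgroup G) (hK : IsOpen (K : Set G)) (hKc : IsCompact (K : Set G)) (hO : IsClosed {g | ∃ y : G, y * γ * y⁻¹ = g})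
    (s : Finset (DoubleCoset.Quotient (K : Set G) (Subgroup.centralizer ({γ} : Set G) : Set G)))
    (hs : ∀ q, q ∉ s → q.out * γ * q.out⁻¹ ∉ K) :
    classOrbitalIntegral m ((K : Set G).indicator fun _ => (1 : ℂ)) (ConjClasses.mk γ) =
      (((ν K).toReal : ℝ) : ℂ) * ∑ q ∈ s, (K : Set G).indicator (fun _ => (1 : ℂ)) (q.out * γ * q.out⁻¹) *
        ((((K.comap (MulAut.conj q.out).toMonoidHom).subgroupOf (Subgroup.centralizer ({γ} : Set G))).relIndex C₀ : ℕ) : ℂ) := by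
  rw [classOrbitalIntegral_indicator_complex_eq_ofReal,
    classOrbitalIntegral_indicator_eq_mul_sum_relIndex hP hm hγ hcomm C₀ hC₀c hC₀o hcore K hK hKc hO s hs]
  push_cast
  refine congrArg _ (Finset.sum_congr rfl fun q _ => ?_)
  by_cases hq : q.out * γ * q.out⁻¹ ∈ K
  · rw [indicator_of_mem (show q.out * γ * q.out⁻¹ ∈ (K : Set G) from hq), indicator_of_mem (show q.out * γ * q.out⁻¹ ∈ (K : Set G) from hq),
      Pi.one_apply, Complex.ofReal_one]
  · rw [indicator_of_notMem (show q.out * γ * q.out⁻¹ ∉ (K : Set G) from hq), indicator_of_notMem (show q.out * γ * q.out⁻¹ ∉ (K : Set G) from hq),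
      Complex.ofReal_zero]

end Canonical

end Literature.NumberTheory.Automorphic

end
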